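import Literature.Topology.FourManifolds.GenericStageStep
import HarnessLib

/-!
# The generic perturbation step without compactness of the source (finite chart cover instead),
# and with goodness at every perturbed point

Topic `Literature/Topology/FourManifolds`; a variant of the tree's generic step
`Literature.Topology.FourManifolds.exists_boxPerturb_good` (`GenericStageStep.lean`: Whitney,
*Differentiable manifolds* (1936), §II Thm. 6 and §§8–9; the inductive step of the proof that
homotopic embeddings `Mᵐ → Nⁿ` of a compact manifold are isotopic when `n ≥ 2m + 2`), written for
the fact seat of `Literature.Topology.FourManifolds.arcs_ambientIsotopic_rel_of_homotopicRel`
(`OneHandleUniqueness.lean`: arcs homotopic rel ends are ambient isotopic rel ends), where the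
general-position argument runs on a **non-compact** one-dimensional source (a finite union of open
parameter windows, an open subset of `ℝ¹`) and only a compact part of it is covered by boxes.

Three changes with respect to `exists_boxPerturb_good`, same proof:

* the instance `[CompactSpace M]` is replaced by the hypothesis it was used for — finitely many
  chart sources cover `M` (`hF`; automatic for an open subset of the model space, where one chart
  suffices);
* the hypotheses on the input family are split between a set `A` (injective stage differential)
  and a set `A'` (separation of points), used independently (`exists_boxPerturb_good_of_finite_atlas'`;
  the unprimed theorem is the case `A = A'`): in an induction over boxes the differential
  condition can be carried on a larger set than the separation condition;
* the set `K` on which goodness is newly asserted only has to satisfy `ρ ≠ 0` on `K` (instead of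
  `ρ = 1`): the proof shows that the perturbed stages are good at **every point where the bump
  does not vanish** (genericity has a grip there), and uses the hypothesis on `A` only where
  `ρ = 0`.  With `K = {ρ ≠ 0}` every perturbed point is good, so that in an induction over boxes
  covering only part of the source no uncontrolled "spill" region is left at the frontier of the
  cover.

Everything here is proved; no definitions, no named facts.

## References

* H. Whitney, *Differentiable manifolds*, Ann. of Math. (2) 37 (1936), 645–680, §II Thm. 6,
  §§8–9. [Whitney1936]
* J. Milnor, *Lectures on the h-cobordism theorem* (1965), Thm. 8.4 and Remark (PDF p. 56).
  [MilnorHCobordism1965]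
* M. W. Hirsch, *Differential Topology*, GTM 33 (1976), Ch. 3 §2 Thm. 2.5. [HirschDT1976]
-/

open scoped Manifold ContDiff Topology
open Function Set Filter
open _root_.MeasureTheory _root_.MeasureTheory.Measure

noncomputable section

namespace Literature.Topology.FourManifolds

variable {m n : ℕ}

section Step

variable {M : Type*} [TopologicalSpace M] [ChartedSpace (EuclideanSpace ℝ (Fin m)) M]
  [IsManifold (𝓡 m) ∞ M]
  {N : Type*} [TopologicalSpace N] [ChartedSpace (EuclideanSpace ℝ (Fin n)) N]
  [IsManifold (𝓡 n) ∞ N]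

variable [T2Space M]

set_option maxHeartbeats 1600000 in
/-- **The generic perturbation step, finite-atlas form** (Whitney (1936), §§8–9; Hirsch (1976),
Ch. 3 §2 Thm. 2.5), for smooth families `G : ℝ × M → N`, `M` Hausdorff and covered by finitely
many chart sources (`hF`), `n ≥ 2m + 2`, with the hypotheses on the input split between a set
`A` (injective stage differential at the points of `A`) and a set `A'` (the points of `A'` are
separated from all other points of their stage) — the two are used independently by the proof,
and the conclusions are injectivity of the stage differential on `A ∪ K` and separation on
`A' ∪ K`.  Hypotheses: the stages of `G`
are good on `A` (injective stage differential at the points of `A`, and the points of `A` are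
separated from all other points of their stage); `ρ : ℝ × M → [0, 1]` is smooth, `≠ 0` on `K`,
with `tsupport ρ ⊆ R ⊆ Rc`, `R` open, `Rc` compact, `Rc` lying over the source of the
chart of `M` at `u₀` and mapped by `G` into the source of the chart of `N` at `x`; finitely many
compact `C i` are mapped by `G` into open `U i`.  Conclusion: for some tuple of columns `c` the
perturbed family `boxPerturb G x ρ (extChartAt (𝓡 m) u₀) c` is smooth, its stages are good on
`A ∪ K`, it maps each `C i` into `U i`, and it agrees with `G` wherever `ρ` vanishes.  (Same
proof as `exists_boxPerturb_good`; see the module docstring for the two changes.)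
[cite: Whitney1936, §II Thm. 6 and §§8–9] -/
theorem exists_boxPerturb_good_of_finite_atlas'
    (hF : ∃ F : Finset M, ∀ u : M, ∃ v ∈ F, u ∈ (chartAt (EuclideanSpace ℝ (Fin m)) v).source)
    (hn : 2 * m + 2 ≤ n) {G : ℝ × M → N}
    (hG : ContMDiff (𝓘(ℝ, ℝ).prod (𝓡 m)) (𝓡 n) ∞ G) {A A' : Set (ℝ × M)}
    (hAimm : ∀ p ∈ A, Injective (mfderiv (𝓡 m) (𝓡 n) (fun u => G (p.1, u)) p.2))
    (hAinj : ∀ p ∈ A', ∀ u', G (p.1, u') = G p → u' = p.2)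
    {x : N} {u₀ : M} {ρ : ℝ × M → ℝ} (hρ : ContMDiff (𝓘(ℝ, ℝ).prod (𝓡 m)) 𝓘(ℝ, ℝ) ∞ ρ)
    (hρ0 : ∀ p, 0 ≤ ρ p) (hρ1 : ∀ p, ρ p ≤ 1) {K R Rc : Set (ℝ × M)} (hρK : ∀ p ∈ K, ρ p ≠ 0)
    (hRo : IsOpen R) (hsuppR : tsupport ρ ⊆ R) (hRRc : R ⊆ Rc) (hRc : IsCompact Rc)
    (hRcM : Rc ⊆ (univ : Set ℝ) ×ˢ (chartAt (EuclideanSpace ℝ (Fin m)) u₀).source)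
    (hRcN : MapsTo G Rc (chartAt (EuclideanSpace ℝ (Fin n)) x).source)
    {ι : Type*} [Finite ι] {C : ι → Set (ℝ × M)} {U : ι → Set N} (hC : ∀ i, IsCompact (C i))
    (hU : ∀ i, IsOpen (U i)) (hCU : ∀ i, MapsTo G (C i) (U i)) :
    ∃ c : Fin (m + 1) → EuclideanSpace ℝ (Fin n),
      ContMDiff (𝓘(ℝ, ℝ).prod (𝓡 m)) (𝓡 n) ∞ (boxPerturb G x ρ (extChartAt (𝓡 m) u₀) c) ∧
      (∀ p ∈ A ∪ K, Injective (mfderiv (𝓡 m) (𝓡 n)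
        (fun u => boxPerturb G x ρ (extChartAt (𝓡 m) u₀) c (p.1, u)) p.2)) ∧
      (∀ p ∈ A' ∪ K, ∀ u', boxPerturb G x ρ (extChartAt (𝓡 m) u₀) c (p.1, u') =
        boxPerturb G x ρ (extChartAt (𝓡 m) u₀) c p → u' = p.2) ∧
      (∀ i, MapsTo (boxPerturb G x ρ (extChartAt (𝓡 m) u₀) c) (C i) (U i)) ∧
      ∀ p, ρ p = 0 → boxPerturb G x ρ (extChartAt (𝓡 m) u₀) c p = G p := by
  -- ### notation
  set φ := extChartAt (𝓡 m) u₀ with hφ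
  set ψ := extChartAt (𝓡 n) x with hψ
  have hφsrc : φ.source = (chartAt (EuclideanSpace ℝ (Fin m)) u₀).source :=
    extChartAt_source (𝓡 m) u₀
  have hsrcR : MapsTo G R (chartAt (EuclideanSpace ℝ (Fin n)) x).source := fun p hp => hRcN (hRRc hp)
  have hRM : R ⊆ (univ : Set ℝ) ×ˢ (chartAt (EuclideanSpace ℝ (Fin m)) u₀).source :=
    hRRc.trans hRcM
  have hρ0R : ∀ p, p ∉ R → ρ p = 0 := fun p hp => by
    by_contra h
    exact hp (hsuppR (subset_tsupport _ (mem_support.2 h)))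
  have hnotK : ∀ p, ρ p = 0 → p ∉ K := fun p h hK => hρK p hK h
  have hmemA : ∀ p, p ∈ A ∪ K → ρ p = 0 → p ∈ A := fun p hp h => hp.resolve_right (hnotK p h)
  have hmemA' : ∀ p, p ∈ A' ∪ K → ρ p = 0 → p ∈ A' := fun p hp h => hp.resolve_right (hnotK p h)
  have habsρ : ∀ p, |ρ p| ≤ 1 := fun p => abs_le.2 ⟨by linarith [hρ0 p], hρ1 p⟩
  -- ### margins
  obtain ⟨ε₀, hε₀, hε₀P⟩ := exists_pos_forall_chart_add_mem hG.continuous hRc hRcN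
    (isOpen_extChartAt_target (I := 𝓡 n) x) fun p hp =>
      (extChartAt (𝓡 n) x).map_source (by rw [extChartAt_source]; exact hRcN hp)
  have hεi : ∀ i, ∃ ε : ℝ, 0 < ε ∧ ∀ p ∈ C i ∩ Rc, ∀ y : EuclideanSpace ℝ (Fin n), ‖y‖ ≤ ε →
      extChartAt (𝓡 n) x (G p) + y ∈
        (extChartAt (𝓡 n) x).target ∩ (extChartAt (𝓡 n) x).symm ⁻¹' U i := by
    intro i
    refine exists_pos_forall_chart_add_mem hG.continuous (hC i |>.inter_right hRc.isClosed)
      (fun p hp => hRcN hp.2)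
      ((continuousOn_extChartAt_symm x).isOpen_inter_preimage (isOpen_extChartAt_target x) (hU i))
      fun p hp => ⟨(extChartAt (𝓡 n) x).map_source (by rw [extChartAt_source]; exact hRcN hp.2), ?_⟩
    rw [mem_preimage, (extChartAt (𝓡 n) x).left_inv (by rw [extChartAt_source]; exact hRcN hp.2)]
    exact hCU i hp.1
  choose εi hεi_pos hεiP using hεi
  obtain ⟨ε, hεpos, hεle0, hεlei⟩ := exists_pos_le_forall hε₀ hεi_pos
  -- ### a bound for the chart coordinates over `Rc`
  obtain ⟨Y, hY0, hY⟩ : ∃ Y : ℝ, 0 ≤ Y ∧ ∀ p ∈ Rc, ‖φ p.2‖ ≤ Y := by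
    have hcont : ContinuousOn (fun p : ℝ × M => ‖φ p.2‖) Rc := by
      refine ((continuousOn_extChartAt u₀).comp continuousOn_snd fun p hp => ?_).norm
      rw [extChartAt_source]
      exact (hRcM hp).2
    obtain ⟨Y, hY⟩ := hRc.bddAbove_image hcont
    refine ⟨max Y 0, le_max_right _ _, fun p hp => (hY ⟨p, hp, rfl⟩).trans (le_max_left _ _)⟩
  -- ### lifted functions and their differentiability
  set gL : ℝ × EuclideanSpace ℝ (Fin m) → EuclideanSpace ℝ (Fin n) := stageLift m n G u₀ x with hgLdef
  set SL : Set (ℝ × EuclideanSpace ℝ (Fin m)) := stageLiftDom m n G u₀ x with hSLdef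
  set ρL : ℝ × EuclideanSpace ℝ (Fin m) → ℝ := fun z => ρ (z.1, φ.symm z.2) with hρLdef
  set T : Set (ℝ × EuclideanSpace ℝ (Fin m)) := (univ : Set ℝ) ×ˢ φ.target with hTdef
  set PA : Set (ℝ × EuclideanSpace ℝ (Fin m)) :=
    {z | z.2 ∈ φ.target ∧ ((z.1, φ.symm z.2) : ℝ × M) ∈ R} with hPAdef
  have hTo : IsOpen T := isOpen_univ.prod (isOpen_extChartAt_target u₀)
  have hSLo : IsOpen SL := isOpen_stageLiftDom hG.continuous u₀ x
  have hPAT : PA ⊆ T := fun z hz => ⟨mem_univ _, hz.1⟩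
  have hPASL : PA ⊆ SL := fun z hz => ⟨hz.1, hsrcR hz.2⟩
  have hPAo : IsOpen PA := by
    have h := (continuousOn_prod_extChartAt_symm (m := m) u₀).isOpen_inter_preimage hTo hRo
    convert h using 1
    ext z
    simp only [hPAdef, mem_setOf_eq, mem_inter_iff, mem_prod, mem_univ, true_and,
      mem_preimage]
    exact Iff.rfl
  have hρLd' : ContDiffOn ℝ ∞ ρL T := contDiffOn_bump_lift hρ u₀
  have hρLd : DifferentiableOn ℝ ρL T := hρLd'.differentiableOn (by simp)
  have hDρLd : DifferentiableOn ℝ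
      (fun q : (ℝ × EuclideanSpace ℝ (Fin m)) × EuclideanSpace ℝ (Fin m) =>
        fderiv ℝ ρL q.1 ((0 : ℝ), q.2)) (T ×ˢ univ) := by
    have h1 : DifferentiableOn ℝ (fun q : (ℝ × EuclideanSpace ℝ (Fin m)) × EuclideanSpace ℝ (Fin m) =>
        fderiv ℝ ρL q.1) (T ×ˢ univ) :=
      ((hρLd'.fderiv_of_isOpen hTo (m := ∞) (by simp)).differentiableOn (by simp)).comp
        differentiableOn_fst fun q hq => hq.1
    exact h1.clm_apply (((differentiable_const _).prodMk differentiable_snd).differentiableOn)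
  have hgLd : DifferentiableOn ℝ gL SL := (contDiffOn_stageLift hG u₀ x).differentiableOn (by simp)
  have hDgLd := differentiableOn_fderiv_stageLift_apply hG u₀ x
  -- ### the finite atlas for the second point of a coincidence
  obtain ⟨F, hF⟩ := hF
  -- ### dimensions and the measure
  set μ : Measure (Fin (m + 1) → EuclideanSpace ℝ (Fin n)) := volume with hμ
  have hdim : Module.finrank ℝ ((ℝ × EuclideanSpace ℝ (Fin m)) × EuclideanSpace ℝ (Fin m)) <
      Module.finrank ℝ (EuclideanSpace ℝ (Fin n)) := by
    rw [Module.finrank_prod, Module.finrank_prod, Module.finrank_self, finrank_euclideanSpace_fin,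
      finrank_euclideanSpace_fin]
    omega
  -- ### (A) non-injective stage differential where the perturbation has a grip
  set aA : Fin (m + 1) → (ℝ × EuclideanSpace ℝ (Fin m)) × EuclideanSpace ℝ (Fin m) → ℝ :=
    fun j q => stageCoef (fderiv ℝ ρL q.1 ((0 : ℝ), q.2)) (ρL q.1) q.1.2 q.2 j with haA
  set BadA : Set (Fin (m + 1) → EuclideanSpace ℝ (Fin n)) := {c | ∃ q ∈ PA ×ˢ (univ : Set (EuclideanSpace ℝ (Fin m))),
    (∃ j, aA j q ≠ 0) ∧ ∑ j, aA j q • c j = -(fderiv ℝ gL q.1 ((0 : ℝ), q.2))} with hBadA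
  have hBadA0 : μ BadA = 0 := by
    refine addHaar_setOf_exists_sum_smul_eq μ hdim (fun j => ?_) ((hDgLd.mono
      (prod_mono hPASL Subset.rfl)).neg)
    have hd : DifferentiableOn ℝ (fun q : (ℝ × EuclideanSpace ℝ (Fin m)) × EuclideanSpace ℝ (Fin m) =>
        fderiv ℝ ρL q.1 ((0 : ℝ), q.2)) (PA ×ˢ univ) := hDρLd.mono (prod_mono hPAT Subset.rfl)
    have hs : DifferentiableOn ℝ (fun q : (ℝ × EuclideanSpace ℝ (Fin m)) × EuclideanSpace ℝ (Fin m) =>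
        ρL q.1) (PA ×ˢ univ) := hρLd.comp differentiableOn_fst fun q hq => hPAT hq.1
    refine Fin.lastCases ?_ (fun i => ?_) j
    · simp only [haA, stageCoef_last]
      exact hd
    · simp only [haA, stageCoef_castSucc]
      exact (hd.mul (differentiable_proj_fst_snd i).differentiableOn).add
        (hs.mul (differentiable_proj_snd i).differentiableOn)
  -- ### (B) coincidence of two perturbed points of the box region
  set sh : (ℝ × EuclideanSpace ℝ (Fin m)) × EuclideanSpace ℝ (Fin m) → ℝ × EuclideanSpace ℝ (Fin m) :=
    fun q => (q.1.1, q.2) with hsh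
  have hshd : Differentiable ℝ sh :=
    (differentiable_fst.comp differentiable_fst).prodMk differentiable_snd
  set PB : Set ((ℝ × EuclideanSpace ℝ (Fin m)) × EuclideanSpace ℝ (Fin m)) :=
    {q | q.1 ∈ PA ∧ sh q ∈ PA} with hPB
  set aB : Fin (m + 1) → (ℝ × EuclideanSpace ℝ (Fin m)) × EuclideanSpace ℝ (Fin m) → ℝ :=
    fun j q => pairCoef (ρL q.1) (ρL (sh q)) q.1.2 q.2 j with haB
  set BadB : Set (Fin (m + 1) → EuclideanSpace ℝ (Fin n)) := {c | ∃ q ∈ PB,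
    (∃ j, aB j q ≠ 0) ∧ ∑ j, aB j q • c j = gL (sh q) - gL q.1} with hBadB
  have hBadB0 : μ BadB = 0 := by
    have hs1 : DifferentiableOn ℝ (fun q : (ℝ × EuclideanSpace ℝ (Fin m)) × EuclideanSpace ℝ (Fin m) =>
        ρL q.1) PB := hρLd.comp differentiableOn_fst fun q hq => hPAT hq.1
    have hs2 : DifferentiableOn ℝ (fun q : (ℝ × EuclideanSpace ℝ (Fin m)) × EuclideanSpace ℝ (Fin m) =>
        ρL (sh q)) PB := hρLd.comp hshd.differentiableOn fun q hq => hPAT hq.2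
    refine addHaar_setOf_exists_sum_smul_eq μ hdim (fun j => ?_) ?_
    · refine Fin.lastCases ?_ (fun i => ?_) j
      · simp only [haB, pairCoef_last]
        exact hs1.sub hs2
      · simp only [haB, pairCoef_castSucc]
        exact (hs1.mul (differentiable_proj_fst_snd i).differentiableOn).sub
          (hs2.mul (differentiable_proj_snd i).differentiableOn)
    · exact (hgLd.comp hshd.differentiableOn fun q hq => hPASL hq.2).sub
        (hgLd.comp differentiableOn_fst fun q hq => hPASL hq.1)
  -- ### (C) coincidence of a perturbed point of the box region with another point of the stage,
  -- ### read in the chart of `M` at `v ∈ F`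
  set PC : M → Set ((ℝ × EuclideanSpace ℝ (Fin m)) × EuclideanSpace ℝ (Fin m)) :=
    fun v => {q | q.1 ∈ PA ∧ sh q ∈ stageLiftDom m n G v x} with hPC
  set aC : Fin (m + 1) → (ℝ × EuclideanSpace ℝ (Fin m)) × EuclideanSpace ℝ (Fin m) → ℝ :=
    fun j q => pairCoef (ρL q.1) 0 q.1.2 q.2 j with haC
  set BadC : M → Set (Fin (m + 1) → EuclideanSpace ℝ (Fin n)) := fun v => {c | ∃ q ∈ PC v,
    (∃ j, aC j q ≠ 0) ∧ ∑ j, aC j q • c j = stageLift m n G v x (sh q) - gL q.1} with hBadC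
  have hBadC0 : ∀ v, μ (BadC v) = 0 := by
    intro v
    have hs1 : DifferentiableOn ℝ (fun q : (ℝ × EuclideanSpace ℝ (Fin m)) × EuclideanSpace ℝ (Fin m) =>
        ρL q.1) (PC v) := hρLd.comp differentiableOn_fst fun q hq => hPAT hq.1
    refine addHaar_setOf_exists_sum_smul_eq μ hdim (fun j => ?_) ?_
    · refine Fin.lastCases ?_ (fun i => ?_) j
      · simp only [haC, pairCoef_last, sub_zero]
        exact hs1
      · simp only [haC, pairCoef_castSucc, zero_mul, sub_zero]
        exact hs1.mul (differentiable_proj_fst_snd i).differentiableOn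
    · exact (((contDiffOn_stageLift hG v x).differentiableOn (by simp)).comp hshd.differentiableOn
        fun q hq => hq.2).sub (hgLd.comp differentiableOn_fst fun q hq => hPASL hq.1)
  have hBadC0' : μ (⋃ v ∈ F, BadC v) = 0 :=
    (measure_biUnion_null_iff F.countable_toSet).2 fun v _ => hBadC0 v
  -- ### choice of the parameter
  set O : Set (Fin (m + 1) → EuclideanSpace ℝ (Fin n)) := {c | (1 + m * Y) * ‖c‖ < ε} with hOdef
  have hOo : IsOpen O := isOpen_lt (continuous_const.mul continuous_norm) continuous_const
  have h0O : (0 : Fin (m + 1) → EuclideanSpace ℝ (Fin n)) ∈ O := by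
    simp only [hOdef, mem_setOf_eq, norm_zero, mul_zero]
    exact hεpos
  obtain ⟨c, hcO, hcBad⟩ := exists_mem_notMem_of_measure_zero μ hOo ⟨0, h0O⟩
    (measure_union_null (measure_union_null hBadA0 hBadB0) hBadC0')
  refine ⟨c, ?_⟩
  -- ### smallness consequences
  have hsmall : ∀ p : ℝ × M, ‖ρ p • affCol c (φ p.2)‖ ≤ ε := by
    intro p
    by_cases hpR : p ∈ R
    · have h1 : ‖affCol c (φ p.2)‖ ≤ (1 + m * Y) * ‖c‖ := by
        refine (norm_affCol_le c (φ p.2)).trans ?_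
        have := hY p (hRRc hpR)
        gcongr
      calc ‖ρ p • affCol c (φ p.2)‖ = |ρ p| * ‖affCol c (φ p.2)‖ := by
            rw [norm_smul, Real.norm_eq_abs]
        _ ≤ 1 * ((1 + m * Y) * ‖c‖) := by gcongr; exact habsρ p
        _ ≤ ε := by rw [one_mul]; exact (le_of_lt hcO)
    · rw [hρ0R p hpR, zero_smul, norm_zero]
      exact hεpos.le
  have htgtRc : ∀ p ∈ Rc, ψ (G p) + ρ p • affCol c (φ p.2) ∈ ψ.target := fun p hp =>
    hε₀P p hp _ ((hsmall p).trans hεle0)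
  have htgt : ∀ p ∈ R, ψ (G p) + ρ p • affCol c (φ p.2) ∈ ψ.target := fun p hp =>
    htgtRc p (hRRc hp)
  set G' : ℝ × M → N := boxPerturb G x ρ φ c with hG'def
  have hG's : ContMDiff (𝓘(ℝ, ℝ).prod (𝓡 m)) (𝓡 n) ∞ G' :=
    contMDiff_boxPerturb hG hρ hRo hsuppR hRM hsrcR htgt
  have hG'R : ∀ p ∈ R, G' p ∈ (chartAt (EuclideanSpace ℝ (Fin n)) x).source ∧
      ψ (G' p) = ψ (G p) + ρ p • affCol c (φ p.2) := fun p hp =>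
    boxPerturb_mem_source (hsrcR hp) (htgt p hp)
  have hG'off : ∀ p, p ∉ R → G' p = G p := fun p hp => boxPerturb_of_eq_zero (hρ0R p hp)
  have hG'ev : ∀ p, p ∉ R → G' =ᶠ[𝓝 p] G := fun p hp =>
    boxPerturb_eventuallyEq fun h => hp (hsuppR h)
  -- the lift of `G'` on `PA`
  have hliftPA : ∀ z ∈ PA, ((z.1, φ.symm z.2) : ℝ × M) ∈ R ∧ φ (φ.symm z.2) = z.2 := fun z hz =>
    ⟨hz.2, φ.right_inv hz.1⟩
  have hcoordL : ∀ z ∈ PA, stageLift m n G' u₀ x z = gL z + ρL z • affCol c z.2 := by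
    intro z hz
    obtain ⟨hzR, hzφ⟩ := hliftPA z hz
    have := (hG'R _ hzR).2
    rw [hzφ] at this
    exact this
  have hliftDom' : ∀ z ∈ PA, z ∈ stageLiftDom m n G' u₀ x := fun z hz =>
    ⟨hz.1, (hG'R _ (hliftPA z hz).1).1⟩
  have hfderivL : ∀ z ∈ PA, ∀ w : EuclideanSpace ℝ (Fin m),
      fderiv ℝ (stageLift m n G' u₀ x) z ((0 : ℝ), w) =
        fderiv ℝ gL z ((0 : ℝ), w) + ∑ j, aA j (z, w) • c j := by
    intro z hz w
    have hev : stageLift m n G' u₀ x =ᶠ[𝓝 z] fun z => gL z + ρL z • affCol c z.2 := by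
      filter_upwards [hPAo.mem_nhds hz] with z' hz' using hcoordL z' hz'
    rw [hev.fderiv_eq]
    have hρz : DifferentiableAt ℝ ρL z := hρLd.differentiableAt (hTo.mem_nhds (hPAT hz))
    have hgz : DifferentiableAt ℝ gL z := differentiableAt_stageLift hG (hPASL hz)
    rw [show (fun z => gL z + ρL z • affCol c z.2) = gL + fun z => ρL z • affCol c z.2 from rfl,
      fderiv_add hgz (differentiableAt_smul_affCol hρz c), _root_.add_apply,
      fderiv_smul_affCol_apply_eq_sum hρz]
  refine ⟨hG's, ?_, ?_, ?_, fun p hp => boxPerturb_of_eq_zero hp⟩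
  · -- ### injective stage differentials on `A ∪ K`
    rintro ⟨t, u⟩ hp
    by_cases hpR : ((t, u) : ℝ × M) ∈ R
    · have huφ : u ∈ φ.source := by rw [hφsrc]; exact (hRM hpR).2
      set z : ℝ × EuclideanSpace ℝ (Fin m) := (t, φ u) with hzdef
      have hzu : φ.symm z.2 = u := φ.left_inv huφ
      have hz : z ∈ PA := by
        refine ⟨φ.map_source huφ, ?_⟩
        change ((t, φ.symm (φ u)) : ℝ × M) ∈ R
        rw [φ.left_inv huφ]
        exact hpR
      have key := injective_mfderiv_stage_iff hG's (hliftDom' z hz)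
      rw [hzu] at key
      change Injective (mfderiv (𝓡 m) (𝓡 n) (fun u => G' (t, u)) u)
      refine key.2 ((injective_iff_map_eq_zero _).2 fun w hw => ?_)
      by_contra hw0
      rw [ContinuousLinearMap.coe_comp, comp_apply, ContinuousLinearMap.inr_apply,
        hfderivL z hz w] at hw
      have h1 : ∑ j, aA j (z, w) • c j = -(fderiv ℝ gL z ((0 : ℝ), w)) :=
        eq_neg_of_add_eq_zero_right hw
      by_cases hgrip : ∃ j, aA j (z, w) ≠ 0
      · exact hcBad (Or.inl (Or.inl ⟨(z, w), ⟨hz, mem_univ _⟩, hgrip, h1⟩))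
      · push Not at hgrip
        have hzero : stageCoef (fderiv ℝ ρL z ((0 : ℝ), w)) (ρL z) z.2 w = 0 := funext hgrip
        obtain ⟨-, hρw⟩ := (stageCoef_eq_zero_iff _ _ _ _).1 hzero
        have hρz : ρL z = 0 := by
          rcases smul_eq_zero.1 hρw with h | h
          · exact h
          · exact absurd h hw0
        have hρp : ρ (t, u) = 0 := by
          have : ρL z = ρ (t, φ.symm (φ u)) := rfl
          rw [this, φ.left_inv huφ] at hρz
          exact hρz
        have hpA : ((t, u) : ℝ × M) ∈ A := hmemA _ hp hρp
        -- the original stage differential is injective, but kills `w`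
        have key0 := injective_mfderiv_stage_iff hG (hPASL hz)
        rw [hzu] at key0
        have hinj0 := key0.1 (hAimm _ hpA)
        have hsum0 : ∑ j, aA j (z, w) • c j = 0 := by
          rw [Finset.sum_eq_zero]
          intro j _
          rw [hgrip j, zero_smul]
        have : fderiv ℝ gL z ((0 : ℝ), w) = 0 := by
          rw [hsum0] at h1
          exact neg_eq_zero.1 h1.symm
        have h' : ((fderiv ℝ gL z).comp
            (ContinuousLinearMap.inr ℝ ℝ (EuclideanSpace ℝ (Fin m)))) w = 0 := by
          rw [ContinuousLinearMap.coe_comp, comp_apply, ContinuousLinearMap.inr_apply, this]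
        exact hw0 ((injective_iff_map_eq_zero _).1 hinj0 w h')
    · have hev : (fun u => G' (t, u)) =ᶠ[𝓝 u] fun u => G (t, u) :=
        (hG'ev _ hpR).comp_tendsto ((Continuous.prodMk_right t).tendsto u)
      change Injective (mfderiv (𝓡 m) (𝓡 n) (fun u => G' (t, u)) u)
      rw [hev.mfderiv_eq]
      exact hAimm _ (hmemA _ hp (hρ0R _ hpR))
  · -- ### separation of the points of `A ∪ K`
    rintro ⟨t, u⟩ hp u' heq
    by_contra hne
    change G' (t, u') = G' (t, u) at heq
    have fallback : ρ (t, u) = 0 → G' (t, u') = G (t, u') → False := fun h0 h1 => by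
      have hGeq : G (t, u') = G (t, u) := by
        rw [← h1, heq]
        exact boxPerturb_of_eq_zero h0
      exact hne (hAinj _ (hmemA' _ hp h0) u' hGeq)
    by_cases hpR : ((t, u) : ℝ × M) ∈ R
    · have huφ : u ∈ φ.source := by rw [hφsrc]; exact (hRM hpR).2
      set z : ℝ × EuclideanSpace ℝ (Fin m) := (t, φ u) with hzdef
      have hz : z ∈ PA := by
        refine ⟨φ.map_source huφ, ?_⟩
        change ((t, φ.symm (φ u)) : ℝ × M) ∈ R
        rw [φ.left_inv huφ]
        exact hpR
      have hρu : ρ (t, u) = ρL z := by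
        change ρ (t, u) = ρ (t, φ.symm (φ u))
        rw [φ.left_inv huφ]
      have hgLz : gL z = ψ (G (t, u)) := by
        change ψ (G (t, φ.symm (φ u))) = ψ (G (t, u))
        rw [φ.left_inv huφ]
      by_cases hp'R : ((t, u') : ℝ × M) ∈ R
      · have hu'φ : u' ∈ φ.source := by rw [hφsrc]; exact (hRM hp'R).2
        set y' : EuclideanSpace ℝ (Fin m) := φ u' with hy'def
        have hz' : ((t, y') : ℝ × EuclideanSpace ℝ (Fin m)) ∈ PA := by
          refine ⟨φ.map_source hu'φ, ?_⟩
          change ((t, φ.symm (φ u')) : ℝ × M) ∈ R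
          rw [φ.left_inv hu'φ]
          exact hp'R
        have hρu' : ρ (t, u') = ρL (t, y') := by
          change ρ (t, u') = ρ (t, φ.symm (φ u'))
          rw [φ.left_inv hu'φ]
        have hyy' : φ u ≠ y' := fun h => hne ((φ.injOn hu'φ huφ) h.symm)
        have hE : gL z + ρL z • affCol c z.2 = gL (t, y') + ρL (t, y') • affCol c y' := by
          rw [← hcoordL _ hz, ← hcoordL _ hz']
          change ψ (G' (t, φ.symm (φ u))) = ψ (G' (t, φ.symm (φ u')))
          rw [φ.left_inv huφ, φ.left_inv hu'φ, heq]
        have hE2 : ∑ j, aB j (z, y') • c j = gL (sh (z, y')) - gL z := by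
          change ∑ j, pairCoef (ρL z) (ρL (t, y')) z.2 y' j • c j = gL (t, y') - gL z
          rw [sum_pairCoef_smul_eq, sub_eq_sub_iff_add_eq_add, add_comm]
          exact hE
        by_cases hgrip : ∃ j, aB j (z, y') ≠ 0
        · exact hcBad (Or.inl (Or.inr ⟨(z, y'), ⟨hz, hz'⟩, hgrip, hE2⟩))
        · push Not at hgrip
          obtain ⟨h1, h2⟩ := eq_of_pairCoef_eq_zero (m := m) hgrip
          have hρz : ρL z = 0 := by
            by_contra hρne
            rw [← h1] at h2
            exact hyy' (smul_right_injective _ hρne h2)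
          have hρz' : ρL (t, y') = 0 := h1 ▸ hρz
          exact fallback (hρu.trans hρz) (boxPerturb_of_eq_zero (hρu'.trans hρz'))
      · have hG'p' : G' (t, u') = G (t, u') := hG'off _ hp'R
        by_cases hsrc' : G (t, u') ∈ (chartAt (EuclideanSpace ℝ (Fin n)) x).source
        · obtain ⟨v, hvF, hu'v⟩ := hF u'
          set y'' : EuclideanSpace ℝ (Fin m) := extChartAt (𝓡 m) v u' with hy''def
          have hu'v' : u' ∈ (extChartAt (𝓡 m) v).source := by rwa [extChartAt_source]
          have hq : ((z, y'') : (ℝ × EuclideanSpace ℝ (Fin m)) × EuclideanSpace ℝ (Fin m)) ∈ PC v := by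
            refine ⟨hz, (extChartAt (𝓡 m) v).map_source hu'v', ?_⟩
            change G (t, (extChartAt (𝓡 m) v).symm (extChartAt (𝓡 m) v u')) ∈ _
            rw [(extChartAt (𝓡 m) v).left_inv hu'v']
            exact hsrc'
          have hliftv : stageLift m n G v x (sh (z, y'')) = ψ (G (t, u')) := by
            change ψ (G (t, (extChartAt (𝓡 m) v).symm (extChartAt (𝓡 m) v u'))) = ψ (G (t, u'))
            rw [(extChartAt (𝓡 m) v).left_inv hu'v']
          have hE : gL z + ρL z • affCol c z.2 = ψ (G (t, u')) := by
            rw [← hcoordL _ hz]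
            change ψ (G' (t, φ.symm (φ u))) = ψ (G (t, u'))
            rw [φ.left_inv huφ, ← heq, hG'p']
          have hE2 : ∑ j, aC j (z, y'') • c j = stageLift m n G v x (sh (z, y'')) - gL z := by
            change ∑ j, pairCoef (ρL z) 0 z.2 y'' j • c j = _
            rw [sum_pairCoef_smul_eq, zero_smul, sub_zero, hliftv, ← hE, add_sub_cancel_left]
          by_cases hρne : ρL z ≠ 0
          · refine hcBad (Or.inr (mem_iUnion₂.2 ⟨v, hvF, (z, y''), hq, ⟨Fin.last m, ?_⟩, hE2⟩))
            simpa [haC] using hρne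
          · push Not at hρne
            exact fallback (hρu.trans hρne) hG'p'
        · refine hsrc' ?_
          rw [← hG'p', heq]
          exact (hG'R _ hpR).1
    · have hρu : ρ (t, u) = 0 := hρ0R _ hpR
      have hG'p : G' (t, u) = G (t, u) := hG'off _ hpR
      by_cases hp'R : ((t, u') : ℝ × M) ∈ R
      · by_cases hsrc : G (t, u) ∈ (chartAt (EuclideanSpace ℝ (Fin n)) x).source
        · have hu'φ : u' ∈ φ.source := by rw [hφsrc]; exact (hRM hp'R).2
          set z' : ℝ × EuclideanSpace ℝ (Fin m) := (t, φ u') with hz'def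
          have hz' : z' ∈ PA := by
            refine ⟨φ.map_source hu'φ, ?_⟩
            change ((t, φ.symm (φ u')) : ℝ × M) ∈ R
            rw [φ.left_inv hu'φ]
            exact hp'R
          have hρu' : ρ (t, u') = ρL z' := by
            change ρ (t, u') = ρ (t, φ.symm (φ u'))
            rw [φ.left_inv hu'φ]
          obtain ⟨v, hvF, huv⟩ := hF u
          have huv' : u ∈ (extChartAt (𝓡 m) v).source := by rwa [extChartAt_source]
          set y'' : EuclideanSpace ℝ (Fin m) := extChartAt (𝓡 m) v u with hy''def
          have hq : ((z', y'') : (ℝ × EuclideanSpace ℝ (Fin m)) × EuclideanSpace ℝ (Fin m)) ∈ PC v := by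
            refine ⟨hz', (extChartAt (𝓡 m) v).map_source huv', ?_⟩
            change G (t, (extChartAt (𝓡 m) v).symm (extChartAt (𝓡 m) v u)) ∈ _
            rw [(extChartAt (𝓡 m) v).left_inv huv']
            exact hsrc
          have hliftv : stageLift m n G v x (sh (z', y'')) = ψ (G (t, u)) := by
            change ψ (G (t, (extChartAt (𝓡 m) v).symm (extChartAt (𝓡 m) v u))) = ψ (G (t, u))
            rw [(extChartAt (𝓡 m) v).left_inv huv']
          have hE : gL z' + ρL z' • affCol c z'.2 = ψ (G (t, u)) := by
            rw [← hcoordL _ hz']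
            change ψ (G' (t, φ.symm (φ u'))) = ψ (G (t, u))
            rw [φ.left_inv hu'φ, heq, hG'p]
          have hE2 : ∑ j, aC j (z', y'') • c j = stageLift m n G v x (sh (z', y'')) - gL z' := by
            change ∑ j, pairCoef (ρL z') 0 z'.2 y'' j • c j = _
            rw [sum_pairCoef_smul_eq, zero_smul, sub_zero, hliftv, ← hE, add_sub_cancel_left]
          by_cases hρne : ρL z' ≠ 0
          · refine hcBad (Or.inr (mem_iUnion₂.2 ⟨v, hvF, (z', y''), hq, ⟨Fin.last m, ?_⟩, hE2⟩))
            simpa [haC] using hρne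
          · push Not at hρne
            exact fallback hρu (boxPerturb_of_eq_zero (hρu'.trans hρne))
        · refine hsrc ?_
          rw [← hG'p, ← heq]
          exact (hG'R _ hp'R).1
      · exact fallback hρu (hG'off _ hp'R)
  · -- ### the constraints `C i ↦ U i`
    intro i p hpC
    by_cases hρp : ρ p = 0
    · change boxPerturb G x ρ φ c p ∈ U i
      rw [boxPerturb_of_eq_zero hρp]
      exact hCU i hpC
    · have hpR : p ∈ R := by
        by_contra h
        exact hρp (hρ0R p h)
      obtain ⟨-, hyU⟩ := hεiP i p ⟨hpC, hRRc hpR⟩ _ ((hsmall p).trans (hεlei i))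
      change boxPerturb G x ρ φ c p ∈ U i
      rw [boxPerturb_eq_of_mem_source (hsrcR hpR)]
      exact hyU


/-- **The generic perturbation step, finite-atlas form** (Whitney (1936), §§8–9; Hirsch (1976),
Ch. 3 §2 Thm. 2.5): `exists_boxPerturb_good_of_finite_atlas'` with one set `A = A'` on which the
input stages are good, as in the tree's `exists_boxPerturb_good` (which is the case of a compact
`M`, `hF` from `exists_finset_chart_cover`, and `K ⊆ {ρ = 1}`).
[cite: Whitney1936, §II Thm. 6 and §§8–9] -/
theorem exists_boxPerturb_good_of_finite_atlas
    (hF : ∃ F : Finset M, ∀ u : M, ∃ v ∈ F, u ∈ (chartAt (EuclideanSpace ℝ (Fin m)) v).source)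
    (hn : 2 * m + 2 ≤ n) {G : ℝ × M → N}
    (hG : ContMDiff (𝓘(ℝ, ℝ).prod (𝓡 m)) (𝓡 n) ∞ G) {A : Set (ℝ × M)}
    (hAimm : ∀ p ∈ A, Injective (mfderiv (𝓡 m) (𝓡 n) (fun u => G (p.1, u)) p.2))
    (hAinj : ∀ p ∈ A, ∀ u', G (p.1, u') = G p → u' = p.2)
    {x : N} {u₀ : M} {ρ : ℝ × M → ℝ} (hρ : ContMDiff (𝓘(ℝ, ℝ).prod (𝓡 m)) 𝓘(ℝ, ℝ) ∞ ρ)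
    (hρ0 : ∀ p, 0 ≤ ρ p) (hρ1 : ∀ p, ρ p ≤ 1) {K R Rc : Set (ℝ × M)} (hρK : ∀ p ∈ K, ρ p ≠ 0)
    (hRo : IsOpen R) (hsuppR : tsupport ρ ⊆ R) (hRRc : R ⊆ Rc) (hRc : IsCompact Rc)
    (hRcM : Rc ⊆ (univ : Set ℝ) ×ˢ (chartAt (EuclideanSpace ℝ (Fin m)) u₀).source)
    (hRcN : MapsTo G Rc (chartAt (EuclideanSpace ℝ (Fin n)) x).source)
    {ι : Type*} [Finite ι] {C : ι → Set (ℝ × M)} {U : ι → Set N} (hC : ∀ i, IsCompact (C i))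
    (hU : ∀ i, IsOpen (U i)) (hCU : ∀ i, MapsTo G (C i) (U i)) :
    ∃ c : Fin (m + 1) → EuclideanSpace ℝ (Fin n),
      ContMDiff (𝓘(ℝ, ℝ).prod (𝓡 m)) (𝓡 n) ∞ (boxPerturb G x ρ (extChartAt (𝓡 m) u₀) c) ∧
      (∀ p ∈ A ∪ K, Injective (mfderiv (𝓡 m) (𝓡 n)
        (fun u => boxPerturb G x ρ (extChartAt (𝓡 m) u₀) c (p.1, u)) p.2)) ∧
      (∀ p ∈ A ∪ K, ∀ u', boxPerturb G x ρ (extChartAt (𝓡 m) u₀) c (p.1, u') =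
        boxPerturb G x ρ (extChartAt (𝓡 m) u₀) c p → u' = p.2) ∧
      (∀ i, MapsTo (boxPerturb G x ρ (extChartAt (𝓡 m) u₀) c) (C i) (U i)) ∧
      ∀ p, ρ p = 0 → boxPerturb G x ρ (extChartAt (𝓡 m) u₀) c p = G p :=
  exists_boxPerturb_good_of_finite_atlas' hF hn hG hAimm hAinj hρ hρ0 hρ1 hρK hRo hsuppR hRRc hRc
    hRcM hRcN hC hU hCU

end Step

end Literature.Topology.FourManifolds
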